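import Literature.Geometry.Lorentzian.ConformalFlow
import HarnessLib

/-!
# Minimal area enclosures, and the corrected form of the Penrose inequality conjecture (gr.S08)
(family `gr`, statement **gr.S08**; namespace `Literature.Geometry.Lorentzian`)

`PenroseInequalityConjecture` of `MassInequalities.lean` bounds the ADM mass `m = √(E² - |P|²)`
of complete asymptotically flat data obeying the dominant energy condition from below by
`√(|S|/16π)`, where `|S| = S.surfaceArea` is the **area of the outermost MOTS `S` itself**. Away
from time symmetry this is not the Penrose conjecture but the "apparent horizon Penrose
inequality", and that inequality is **false**. Ben-Dov, Phys. Rev. D 70 (2004) 124031, §4,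
matches four spherically symmetric regions — from the centre outwards: a ball `χ ≤ χ₂` of a
closed dust-filled FLRW universe; a region of the Kruskal spacetime of mass `M₁`; a shell
`χ₁ ≤ χ ≤ χ₀` of a second closed dust FLRW universe in its *expanding* phase; and the exterior of
a Schwarzschild spacetime of mass `M`, which carries the only asymptotically flat end — with
`M₁ = ½ a_m sin³χ₁ > ½ a_m sin³χ₀ = M` (`π/2 ≤ χ₁ < χ₀ < π`), into a spacetime satisfying the
dominant energy condition, and exhibits a complete spherically symmetric asymptotically flat
slice (of constant Kruskal time in the two vacuum regions, constant conformal time in the dust)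
whose apparent horizon — the outermost marginally outer trapped surface, the boundary of the
outer trapped region — is the round sphere `r = 2M₁` of the intermediate Kruskal region, there
being no marginally outer trapped sphere outside it. Its area is `A = 16π M₁² > 16π M²` while the
ADM mass of the slice is `M` (its ADM momentum vanishes), so `M < √(A/16π)`; letting `χ₀ → π`
makes `M/√(A/16π)` as small as desired (loc. cit., §4: *"for all `ε > 0` there exists a spacetime
and a slice as described above producing initial data with `M < ε√(A/16π)`"*). Both sources cited
by the tree's statement record this. Mars, Class. Quantum Grav. 26 (2009) 193001, §3: *"one can
often find in the literature a version of the Penrose inequality involving the area of the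
outermost MOTS, `M_ADM ≥ √(|∂𝒯⁺_Σ|/16π)`. This is of course a stronger and simpler looking
inequality. However, it is presently known not to be true. A counterexample has been found by
I. Ben-Dov"*; Andersson–Metzger, Comm. Math. Phys. 290 (2009) 941–972, §1: *"a counter example
due to Ben-Dov shows that an inequality between the area of the outermost MOTS and the ADM mass
does not hold in general."*

What Penrose's heuristic chain (Penrose 1973: weak cosmic censorship puts the outer trapped
region behind the event horizon; Hawking's area theorem; settling to Kerr; Bondi mass loss)
supports is the inequality for the **minimal area enclosure** of the outermost MOTS: the event
horizon cut `ℋ_Σ` *encloses* `∂𝒯⁺_Σ` but need not have larger area than it — it has at least the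
least area `A_min(∂𝒯⁺_Σ)` of a surface enclosing `∂𝒯⁺_Σ`. Mars 2009, §3: *"for spacetime
dimensions `n ≤ 8` any surface `S` that bounds an exterior domain always has a minimal area
enclosure, i.e. the outermost of all surfaces which enclose `S` and have less or equal area than
any other surface enclosing `S`. We will denote by `A_min(S)` the area of the minimal area
enclosure of `S` … the Penrose inequality can be written in the simpler form
`M_ADM ≥ √(A_min(∂𝒯⁺_Σ)/16π)`. Although the Penrose inequality, seen as a consequence of cosmic
censorship, should be expected to hold only for the minimum area enclosure of `∂𝒯⁺_Σ` …"*;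
Ben-Dov 2004, §1: *"The Penrose inequality: Given any asymptotically flat initial data satisfying
the dominant energy condition then `M ≥ √(𝒜/16π)` with `M` the total mass and `𝒜` the minimum
area required to enclose the apparent horizon."* Here (Mars 2009, §3) surfaces are *weakly outer
trapped boundaries*: boundaries `S = ∂Ω⁺` of exterior domains `Ω⁺` containing the chosen
asymptotically flat end, the outer normal pointing into `Ω⁺`; `S₂` *encloses* `S₁` iff
`Ω₁⁺ ⊇ Ω₂⁺`; the outer trapped region `𝒯⁺_Σ` is the union of the interiors `Σ ∖ Ω⁺` of all weakly
outer trapped (`θ₊ ≤ 0`) boundaries, and by Andersson–Metzger 2009, Thm. 7.3, its boundary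
`∂𝒯⁺_Σ` is a smooth MOTS enclosing every weakly outer trapped boundary — the unique outermost
MOTS. In the time-symmetric case an outermost minimal surface is outer-minimizing
(Huisken–Ilmanen 2001, Lemma 4.1 (ii); Bray 2001, p. 185), `A_min(∂𝒯⁺_Σ) = |∂𝒯⁺_Σ|`, and the
statement is the Riemannian Penrose inequality (gr.S09, a theorem: Huisken–Ilmanen 2001, Bray
2001). In general it is **open** (Mars 2009, §3 and §7; even for the stronger version with
`|∂(𝒯⁺_Σ ∪ 𝒯⁻_Σ)|` *"so far no counterexample … has been found"*, loc. cit. §3); it holds in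
spherical symmetry (Mars 2009, §4).

This file vendors the one notion the corrected statement needs, and records that statement:

* `minimalEnclosureArea h e U₀ : ℝ≥0∞` — **`A_min(Σ)` for `Σ = frontier U₀`**, `U₀` the exterior
  domain bounded by `Σ`: the infimum of the areas `area h (frontier V)` (`Volume.lean`: the
  `2`-dimensional Euclidean-normalised Hausdorff measure of the length metric of `h`) over the
  outside regions `V ⊆ U₀` of surfaces of Bray's class `𝒮` (`IsCalS h e V`, `ConformalFlow.lean`:
  `frontier V` is a compact smoothly embedded surface with unit normal pointing into `V`, `V` on
  one side of it, and `V` is the connected exterior region of the end `e`), i.e. over the smooth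
  boundaries of exterior domains enclosing `Σ`. API (proved): `minimalEnclosureArea_le`,
  `le_minimalEnclosureArea_iff`, `minimalEnclosureArea_anti` (enclosing a larger exterior domain
  costs no more), `minimalEnclosureArea_le_area_frontier` (`A_min(Σ) ≤ |Σ|` for `Σ ∈ 𝒮`),
  `IsOutsideOf.minimalEnclosureArea_le_area_range`, the identification
  `IsMinimalAreaEnclosure.minimalEnclosureArea_eq` with the area of a minimal area enclosure in
  Bray's sense (`ConformalFlow.lean`, conformal factor `1`) when `𝒮` contains one, and
  `IsOuterMinimizing.minimalEnclosureArea_eq` (`A_min(Σ) = |Σ|` for outer-minimizing `Σ`, the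
  time-symmetric mechanism above).
* the **corrected form of gr.S08** (Mars 2009, §3, the inequality
  `M_ADM ≥ √(A_min(∂𝒯⁺_Σ)/16π)`; Ben-Dov 2004, §1, "The Penrose inequality"; Penrose 1973): for
  complete data `(X, h, k)` on a connected `3`-manifold satisfying the dominant energy condition,
  asymptotically flat of order `1` on the end `e` with existing ADM energy and momentum limits,
  and an outermost MOTS `S : OutermostMOTS (𝓡 3) D.h D.k` with smooth unit normal which bounds the
  exterior domain `S.exterior` of the end `e` on one side (`IsOutsideOf e S.exterior S.f S.ν`: a
  weakly outer trapped *boundary*) and encloses every surface weakly outer trapped towards `e`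
  (`IsWeaklyOuterTrappedFree D.h D.k e S.exterior`, so that `S = ∂𝒯⁺_Σ`):
  `√(A_min(S)/16π) ≤ m = √(E² - |P|²)`. It is an open conjecture, hence a `Prop`-valued `def`
  without proof (CONVENTIONS §4); such a definition cannot be added by the fact-proving seat that
  found the discrepancy (D-0026: a proving unit may not add undischarged named `Prop`s), so its
  Lean text — which elaborates against this file as checked on 2026-08-15 — is **recorded in the
  section "The corrected statement" below, to be declared (here, under the name
  `PenroseInequalityEnclosureConjecture`) by the owner of the gr.S08 statement**.

## What is wrong with `PenroseInequalityConjecture`, precisely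

Its conclusion `√(S.surfaceArea/16π) ≤ e.admMass D` uses the area of `S`. Read informally,
Ben-Dov's slice meets every hypothesis of that statement — complete (the innermost closed FLRW
ball caps what would be a second end; loc. cit., §4, footnote: *"Portion 4 is taken only to
'close the cap' on the other asymptotically flat region"*); dominant energy condition (dust and
vacuum); asymptotically flat of every order on the Schwarzschild end of mass `M`, where a slice of
constant Kruskal time approaches the time-symmetric slice `t = 0` together with all derivatives
exponentially fast in `r`, so `E = M`, `P = 0`, `m = M`; `S` the outermost MOTS, no weakly outer
trapped surface outside it (spherical symmetry and the uniqueness of `∂𝒯⁺_Σ`, Andersson–Metzger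
2009, Thm. 7.3, reduce this to round spheres), bounding the connected exterior region of the end
— and violates the conclusion by an arbitrary factor. (The matched spacetime is smooth away from
three junction hypersurfaces, across which it is only `C¹`; the sources quoted above state the
apparent-horizon version to be false without qualification, and smoothing the dust profile is
routine.) Independently, the statement inherits the regularity gap of `OutermostMOTS.ν` recorded in
`MassInequalities.lean` (docstring heading its section gr.S09: the intended statement has `S.ν`
smooth). Hence no `_holds` theorem can land for `PenroseInequalityConjecture`; a Lean refutation
would require the whole matched-spacetime construction with its trapped-surface analysis and is
not attempted. The corrected statement (i) replaces `|S|` by `A_min(S)`, (ii) adds the smoothness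
of `S.ν` (as `riemannian_penrose_inequality_connected_smooth` does), and (iii) asks `S` to bound
its exterior domain on one side — `IsOutsideOf e S.exterior S.f S.ν`, whose clauses are
`S.frontier_exterior`, `S.pointsInto`, one-sidedness, and the former hypothesis
`IsExteriorRegion e S.exterior` — as Mars's weakly outer trapped boundaries do; every other
hypothesis, and the mass `e.admMass D`, are kept verbatim. `PenroseInequalityConjecture` itself is
left untouched (ledger-referenced name; its docstring already carries the `S.ν` caveat).

## The corrected statement

To be declared in this file, after `end MinimalEnclosure`, with the docstring material above
(cite tag `[cite: Mars2009, §3 (the inequality M_ADM ≥ √(A_min(∂T⁺_Σ)/16π))]`); it elaborates as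
written against the imports and definitions of this file:

```
def PenroseInequalityEnclosureConjecture : Prop :=
  ∀ (X : Type) [TopologicalSpace X] [ChartedSpace E3 X] [IsManifold (𝓡 3) ∞ X] [T2Space X]
    [SecondCountableTopology X] [LocallyCompactSpace X] [ConnectedSpace X]
    [MeasurableSpace X] [BorelSpace X]
    (D : InitialDataSet (𝓡 3) X) [D.metric.HasLeviCivita] (e : AFEnd X)
    (S : OutermostMOTS (𝓡 3) D.h D.k),
    ContMDiff (𝓡 2) (𝓡 3).tangent ∞
      (fun y ↦ (TotalSpace.mk' E3 (S.f y) (S.ν y) : TangentBundle (𝓡 3) X)) →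
    D.SatisfiesDominantEnergyCondition → e.IsAsymptoticallyFlat D 1 → D.IsComplete →
    (∃ m, e.HasADMEnergy D m) → (∀ i, ∃ p, e.HasADMMomentum D i p) →
    IsWeaklyOuterTrappedFree D.h D.k e S.exterior → IsOutsideOf e S.exterior S.f S.ν →
    Real.sqrt ((minimalEnclosureArea D.h e S.exterior).toReal / (16 * π)) ≤ e.admMass D
```

Reading: for every complete initial data set `(X, h, k)` on a connected `3`-manifold `X`
(`X : Type`) satisfying the dominant energy condition, asymptotically flat of order `1` on an end
`e` whose ADM energy and momentum limits exist, and every outermost MOTS `S` (`θ⁺ = tr_S k + H = 0`)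
whose unit normal `S.ν` is smooth as a map into `TX` (so that `S.isMOTS` is the honest equation
`θ⁺ = 0`), which bounds the exterior domain `S.exterior` of the end `e` on one side
(`IsOutsideOf e S.exterior S.f S.ν`: `S` is the boundary of `S.exterior`, `S.ν` points into it and
`-S.ν` out of its closure, and `S.exterior` is the connected exterior region of `e`, compact modulo
the end — a weakly outer trapped boundary in the sense of Mars 2009, §3) and whose exterior
contains no surface weakly outer trapped (`θ⁺ ≤ 0`) towards `e`
(`IsWeaklyOuterTrappedFree D.h D.k e S.exterior`: `S` encloses the whole outer trapped region
`𝒯⁺_Σ` of the end, i.e. `S = ∂𝒯⁺_Σ`, the apparent horizon — Andersson–Metzger 2009, Thm. 7.3), the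
ADM mass `m = √(E² - |P|²)` satisfies `√(A_min(S)/16π) ≤ m` with
`A_min(S) = minimalEnclosureArea D.h e S.exterior`. In the time-symmetric case `A_min(S) = |S|`
(outermost minimal surfaces are outer-minimizing, `IsOuterMinimizing.minimalEnclosureArea_eq`)
and this is the Riemannian Penrose inequality (gr.S09).

## Design

* *`A_min` is an infimum, not the area of a minimiser.* The outermost minimal area enclosure
  exists and is unique (Bray 2001, §4 after Def. 10; Mars 2009, §3, `n ≤ 8`) but is in general
  only `C^{1,1}` across the rim where it lifts off `Σ` (Huisken–Ilmanen 2001, §1, Thm. 1.3 (iii)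
  and (1.15), for the strictly minimizing hull `E'`), so it need not be a surface of `𝒮`, and a
  statement of the form "for every minimal area enclosure `V` of `Σ` in `𝒮`, `√(|∂V|/16π) ≤ m`"
  could be vacuous.
  The infimum over smooth enclosures needs neither existence nor regularity, equals the area of
  the minimiser when there is one (push it off `Σ` along the outer normal and mollify: areas
  converge), and agrees with Bray's notion whenever `𝒮` does contain a minimiser
  (`IsMinimalAreaEnclosure.minimalEnclosureArea_eq`). Restricting competitors to *connected*,
  *one-sided* outside regions (the clauses of `IsCalS`/`IsOutsideOf`) does not change the
  infimum: dropping a bounded component of an outside region, or a two-sided piece of its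
  boundary, only removes area.
* *Currency of areas.* Competitors are known only as boundaries `frontier V`, so their areas are
  the Hausdorff areas `area h` of `Volume.lean`, exactly as for the minimal area enclosures of
  `ConformalFlow.lean`; in particular `A_min(S) ≤ area h (range S.f)`
  (`IsOutsideOf.minimalEnclosureArea_le_area_range`). The agreement of `area h (range S.f)` with
  the parametrised area `S.surfaceArea` (Federer 1969, 3.2.3) is not in the tree, so no formal
  comparison with `PenroseInequalityConjecture` is stated (none is wanted: that statement is the
  refuted one).
* *Binders.* As in `Bray2001_mass_ge_half_capacity` (`MassCapacity.lean`): speaking of `area`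
  needs `[LocallyCompactSpace X]` (automatic for manifolds, `ChartedSpace.locallyCompactSpace`)
  and `[MeasurableSpace X] [BorelSpace X]` (users take `borel X`); otherwise the binders are those
  of `PenroseInequalityConjecture` (`X : Type`, universe `0`, like `OutermostMOTS.surf`).
* *Degenerate values.* `A_min = ∞` only if no enclosing surface of `𝒮` has finite area, which the
  compact smooth `S ∈ 𝒮` excludes (`riemannianVolume_lt_top_of_isCompact_holds`,
  `VolumeProofs.lean`, not imported here); in that junk case `toReal` gives `0` and the conclusion
  reads `0 ≤ m`, true as `m` is a square root. An empty `S` (`S.exterior = X`, one-ended `X`) gives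
  `A_min = 0` and the conclusion `0 ≤ m` — the statement then carries no content beyond
  `0 ≤ √·`, as for `PenroseInequalityConjecture` (the positive mass theorem is gr.S10).
* *Not vendored.* The version with `|∂(𝒯⁺_Σ ∪ 𝒯⁻_Σ)|` (Mars 2009, §3: *"so far no counterexample
  … has been found and it is not clear whether the inequality should hold"* — not supported by
  the heuristic argument); Bray–Khuri's version with the outermost generalized apparent horizon
  (refuted: Carrasco–Mars, Class. Quantum Grav. 27 (2010) 062001); data with boundary `∂X = S`;
  the rigidity (equality) clause.

## References

* R. Penrose, *Naked singularities*, Ann. New York Acad. Sci. 224 (1973) 125–134.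
* I. Ben-Dov, *Penrose inequality and apparent horizons*, Phys. Rev. D 70 (2004) 124031
  (arXiv:gr-qc/0408066): §1 (the displayed statements "The Penrose inequality" and "The apparent
  horizon Penrose inequality"), §2 (trapped regions, apparent horizon), §4 (the counterexample).
* M. Mars, *Present status of the Penrose inequality*, Class. Quantum Grav. 26 (2009) 193001
  (arXiv:0906.5566): §3 (weakly outer trapped boundaries, `𝒯⁺_Σ`, minimal area enclosures and
  `A_min`, the inequalities `M_ADM ≥ sup_S √(A_min(S)/16π)`, `M_ADM ≥ √(A_min(∂𝒯⁺_Σ)/16π)` and the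
  refuted `M_ADM ≥ √(|∂𝒯⁺_Σ|/16π)`), §4 (spherical symmetry).
* L. Andersson, J. Metzger, *The area of horizons and the trapped region*, Comm. Math. Phys. 290
  (2009) 941–972 (arXiv:0708.4252): §1 (the remark on Ben-Dov's example), §7 Defs. 7.1–7.2 and
  Thm. 7.3.
* A. Carrasco, M. Mars, *A counterexample to a recent version of the Penrose conjecture*, Class.
  Quantum Grav. 27 (2010) 062001.
* H. L. Bray, *Proof of the Riemannian Penrose inequality using the positive mass theorem*,
  J. Differential Geom. 59 (2001) 177–267: §2 Defs. 3 and 6, p. 185, §4 Def. 10.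
* G. Huisken, T. Ilmanen, *The inverse mean curvature flow and the Riemannian Penrose
  inequality*, J. Differential Geom. 59 (2001) 353–437: §1 (minimizing hulls, Thm. 1.3 (iii),
  (1.15)), Lemma 4.1 (ii) (*"the boundary of `M'` minimizes area in its homology class"*).
-/

noncomputable section

open Bundle Set Manifold TopologicalSpace Filter MeasureTheory
open scoped ContDiff Topology ENNReal Manifold Real

namespace Literature.Geometry.Lorentzian

open PseudoRiemannianMetric

variable {X : Type} [TopologicalSpace X] [ChartedSpace E3 X]

/-! ### The minimal enclosure area `A_min` -/

section MinimalEnclosure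

variable [IsManifold (𝓡 3) ∞ X]
  (h : ContMDiffRiemannianMetric (𝓡 3) ∞ E3 (TangentSpace (𝓡 3) : X → Type _))
  [T2Space X] [LocallyCompactSpace X] [MeasurableSpace X] [BorelSpace X]

/-- **The minimal enclosure area `A_min(Σ)` of the surface `Σ = frontier U₀` bounding the exterior
domain `U₀` of the end `e`** (Mars, Class. Quantum Grav. 26 (2009) 193001, §3: *"any surface `S`
that bounds an exterior domain always has a minimal area enclosure, i.e. the outermost of all
surfaces which enclose `S` and have less or equal area than any other surface enclosing `S`. We
will denote by `A_min(S)` the area of the minimal area enclosure of `S`"*, where *"`S₂` encloses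
`S₁` provided `Ω₁⁺ ⊇ Ω₂⁺`"* for the exterior domains they bound; Ben-Dov 2004, §1: *"the minimum
area required to enclose the apparent horizon"*), taken as the **infimum** of the areas
`area h (frontier V)` (`2`-dimensional Hausdorff area of the length metric of `h`, `Volume.lean`)
over all outside regions `V ⊆ U₀` of surfaces of Bray's class `𝒮` (`IsCalS h e V`: `frontier V`
is a compact smoothly embedded surface bounding the connected exterior region `V` of `e` on one
side), i.e. over the smooth boundaries of exterior domains enclosing `Σ`. The infimum form needs
neither the existence nor the (`C^{1,1}`) regularity of the minimiser and agrees with the area of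
a minimal area enclosure in Bray's sense when `𝒮` contains one
(`IsMinimalAreaEnclosure.minimalEnclosureArea_eq`); `∞` if there is no competitor (never the case
for `U₀` itself the outside region of a surface of `𝒮`, `minimalEnclosureArea_le_area_frontier`).
[cite: Mars2009, §3 (minimal area enclosure, A_min)] -/
def minimalEnclosureArea (e : AFEnd X) (U₀ : Opens X) : ℝ≥0∞ :=
  ⨅ (V : Opens X) (_ : IsCalS h e V ∧ V ≤ U₀), area h (frontier (V : Set X))

/-- Every smooth enclosing surface bounds `A_min` from above: if `frontier V ∈ 𝒮` encloses
`frontier U₀` (`V ⊆ U₀`) then `A_min(frontier U₀) ≤ |frontier V|`. Mars 2009, §3.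
[cite: Mars2009, §3 (minimal area enclosure, A_min)] -/
theorem minimalEnclosureArea_le {e : AFEnd X} {U₀ V : Opens X} (hV : IsCalS h e V)
    (hle : V ≤ U₀) : minimalEnclosureArea h e U₀ ≤ area h (frontier (V : Set X)) :=
  iInf₂_le V ⟨hV, hle⟩

/-- Characterisation of lower bounds of `A_min`: `a ≤ A_min(frontier U₀)` iff `a` is at most the
area of every smooth surface of `𝒮` enclosing `frontier U₀`. [folklore] -/
theorem le_minimalEnclosureArea_iff {e : AFEnd X} {U₀ : Opens X} {a : ℝ≥0∞} :
    a ≤ minimalEnclosureArea h e U₀ ↔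
      ∀ V : Opens X, IsCalS h e V → V ≤ U₀ → a ≤ area h (frontier (V : Set X)) := by
  simp only [minimalEnclosureArea, le_iInf_iff, and_imp]

/-- `A_min` is antitone in the exterior domain: a surface enclosing `frontier U₀` also encloses
the boundary of any larger exterior domain `U₁ ⊇ U₀`, so `A_min(frontier U₁) ≤ A_min(frontier U₀)`
(Mars 2009, §3: `A_min(∂𝒯⁺_Σ) ≥ A_min(S)` for every weakly outer trapped boundary `S`, which
`∂𝒯⁺_Σ` encloses). [cite: Mars2009, §3 (minimal area enclosure, A_min)] -/
theorem minimalEnclosureArea_anti {e : AFEnd X} {U₀ U₁ : Opens X} (hU : U₀ ≤ U₁) :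
    minimalEnclosureArea h e U₁ ≤ minimalEnclosureArea h e U₀ :=
  le_iInf₂ fun V hV ↦ iInf₂_le V ⟨hV.1, hV.2.trans hU⟩

/-- A surface of `𝒮` encloses itself, so `A_min(frontier U₀) ≤ |frontier U₀|` when `U₀` is the
outside region of a surface of `𝒮`. Mars 2009, §3. [cite: Mars2009, §3 (minimal area enclosure, A_min)] -/
theorem minimalEnclosureArea_le_area_frontier {e : AFEnd X} {U₀ : Opens X} (hU₀ : IsCalS h e U₀) :
    minimalEnclosureArea h e U₀ ≤ area h (frontier (U₀ : Set X)) :=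
  minimalEnclosureArea_le h hU₀ le_rfl

/-- For a compact smoothly embedded surface `f'` with unit normal `ν'` whose outside region
towards `e` is `U` (`IsOutsideOf`), `A_min(range f') ≤ |range f'|` (Hausdorff area of the image).
Mars 2009, §3. [cite: Mars2009, §3 (minimal area enclosure, A_min)] -/
theorem IsOutsideOf.minimalEnclosureArea_le_area_range {e : AFEnd X} {U : Opens X} {S' : Type}
    [TopologicalSpace S'] [ChartedSpace (EuclideanSpace ℝ (Fin 2)) S'] [IsManifold (𝓡 2) ∞ S']
    [CompactSpace S'] [T2Space S'] {f' : S' → X} {ν' : NormalField (𝓡 3) f'}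
    (hU : IsOutsideOf e U f' ν') (hf' : Manifold.IsSmoothEmbedding (𝓡 2) (𝓡 3) ∞ f')
    (hν' : (ofRiemannian h).IsUnitNormal (𝓡 2) f' ν' 1) :
    minimalEnclosureArea h e U ≤ area h (range f') := by
  rw [← hU.frontier_eq]
  exact minimalEnclosureArea_le_area_frontier h (hU.isCalS h hf' hν')

/-- **`A_min` is the area of a minimal area enclosure when `𝒮` contains one**: if `frontier V` is
a minimal area enclosure of `frontier U₀` in `(X, h)` in Bray's sense (`IsMinimalAreaEnclosure`
of `ConformalFlow.lean` with conformal factor `1`: a surface of `𝒮` enclosing `frontier U₀` of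
least area among all such), then `A_min(frontier U₀) = |frontier V|`. Bray 2001, §4 Def. 10;
Mars 2009, §3. [cite: Mars2009, §3 (minimal area enclosure, A_min)] -/
theorem IsMinimalAreaEnclosure.minimalEnclosureArea_eq {e : AFEnd X} {U₀ V : Opens X}
    (hV : IsMinimalAreaEnclosure h (fun _ ↦ (1 : ℝ)) e U₀ V) :
    minimalEnclosureArea h e U₀ = area h (frontier (V : Set X)) := by
  refine le_antisymm (minimalEnclosureArea_le h hV.1 hV.2.1) ?_
  rw [le_minimalEnclosureArea_iff]
  intro V' hV' hle
  simpa only [conformalArea_one] using hV.2.2 V' hV' hle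

/-- **`A_min(Σ) = |Σ|` for an outer-minimizing surface `Σ ∈ 𝒮`** (Bray 2001, §2 Def. 6; the
time-symmetric mechanism: outermost minimal surfaces are outer-minimizing, Huisken–Ilmanen 2001,
Lemma 4.1 (ii), so that the corrected conjecture is then the Riemannian Penrose inequality).
[cite: BrayRPI2001, §2 Def. 6] -/
theorem IsOuterMinimizing.minimalEnclosureArea_eq {e : AFEnd X} {U₀ : Opens X}
    (hU₀ : IsCalS h e U₀) (hmin : IsOuterMinimizing h (fun _ ↦ (1 : ℝ)) e U₀) :
    minimalEnclosureArea h e U₀ = area h (frontier (U₀ : Set X)) := by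
  refine le_antisymm (minimalEnclosureArea_le_area_frontier h hU₀) ?_
  rw [le_minimalEnclosureArea_iff]
  intro V' hV' hle
  simpa only [conformalArea_one] using hmin V' hV' hle

end MinimalEnclosure

end Literature.Geometry.Lorentzian

end
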